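import Summits.BirchSwinnertonDyer.Rank1Residual.X5.SelmerSolitairePivot
import HarnessLib

/-!
# O1 · Selmer solitaire: one-vertex extensions preserve old cores and `𝒳⁰`-connectivity, and admissible
# moves inherit the BAD₁ decoration (monotonicity inputs of T4′)

Cell `b2b-bsdres`, O1 (p = 2) PROVER ORDER v2.8 (ii′) (o1 lead R-G17.8: p4 = PivotRebase → T4′); item (M) of
the T4′ plan `HOME/b2b-bsdres-x11b3-p4/T4PRIME-PLAN.md`.  Pure 𝔽₂ linear algebra; reach-neutral; nothing
booked; no mark; O1 OPEN.  HONEST FRAMING (cell, verbatim): research route; theorems only (no definition,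
no named fact); nothing arithmetic is asserted (lens-2's Prop A "coreness of a vertex `n ⊆ D` does not change
when primes are adjoined" is here the trivial fact that an extension does not change old principal minors).

* `plus_lift` — `(lift n)⁺` is the image of `n⁺` under `oldV`.
* `core_lift_iff` — if `P'` extends `P` then `lift n` is core in `P'` iff `n` is core in `P`.
* `cubeAdj_lift`, `connected_lift` — `𝒳⁰(P)` embeds in `𝒳⁰(P')` along `lift`.
* `bad1Consistent_lift_of_admissibleExtends` — an ADMISSIBLE move inherits the decoration as `(lift A, ε₀)`
  (lens-2 G5.2 T3 (ii): the new row's `u`-coordinate identity IS the admissibility condition).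

References: lens-2 GEN 5, ROUTES-O1 §lens-2 G5.1 (Prop A), G5.2 (T3 (ii)), G5.9; B. Mazur, K. Rubin,
*Kolyvagin systems* (2004) §4.3. [cite: MazurRubin2004, §4.3]
-/

namespace Summit.BirchSwinnertonDyer.Rank1Residual.X5.SelmerSolitaire

open Finset Matrix

variable {s : ℕ}

/-! ## `oldV`, `lift` and `plus` -/

/-- `oldV` is injective. [folklore] -/
theorem oldV_injective : Function.Injective (oldV : V s → V (s + 1)) :=
  Option.map_injective (Fin.castSucc_injective s)

/-- `oldV (some i) = some i.castSucc`. [folklore] -/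
theorem oldV_some (i : Fin s) : oldV (some i : V s) = some i.castSucc := rfl

/-- `oldV ∞ = ∞`. [folklore] -/
theorem oldV_none : oldV (none : V s) = none := rfl

/-- Membership in `lift n`. [folklore] -/
theorem mem_lift_iff (n : Finset (Fin s)) (j : Fin (s + 1)) : j ∈ lift n ↔ ∃ i ∈ n, i.castSucc = j := by
  unfold lift
  rw [Finset.mem_map]
  rfl

/-- `card (lift n) = card n`. [folklore] -/
theorem card_lift (n : Finset (Fin s)) : (lift n).card = n.card := by
  unfold lift
  exact Finset.card_map _

/-- **`(lift n)⁺ = oldV '' n⁺`.** [folklore] -/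
theorem plus_lift (n : Finset (Fin s)) :
    plus (lift n) = (plus n).map ⟨oldV, oldV_injective⟩ := by
  ext v
  rw [Finset.mem_map]
  constructor
  · intro hv
    cases v with
    | none =>
      refine ⟨none, ?_, rfl⟩
      have h := (none_mem_plus_iff (lift n)).mp hv
      rw [card_lift] at h
      exact (none_mem_plus_iff n).mpr h
    | some j =>
      have hj := (some_mem_plus_iff (lift n) j).mp hv
      obtain ⟨i, hi, rfl⟩ := (mem_lift_iff n j).mp hj
      exact ⟨some i, (some_mem_plus_iff n i).mpr hi, rfl⟩
  · rintro ⟨w, hw, rfl⟩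
    cases w with
    | none =>
      have h := (none_mem_plus_iff n).mp hw
      show (none : V (s + 1)) ∈ plus (lift n)
      rw [none_mem_plus_iff, card_lift]
      exact h
    | some i =>
      have hi := (some_mem_plus_iff n i).mp hw
      show (some i.castSucc : V (s + 1)) ∈ plus (lift n)
      rw [some_mem_plus_iff, mem_lift_iff]
      exact ⟨i, hi, rfl⟩

/-! ## Old cores are unchanged by an extension -/

/-- **If `P'` extends `P`, then `lift n` is core in `P'` iff `n` is core in `P`** (the principal minor on
`(lift n)⁺ = oldV '' n⁺` of the extension is the principal minor of `P` on `n⁺`). [cite: MazurRubin2004, §4.3] -/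
theorem core_lift_iff {P : Position s} {P' : Position (s + 1)} (h : Extends P P') (n : Finset (Fin s)) :
    Core P' (lift n) ↔ Core P n := by
  classical
  -- the bijection `n⁺ ≃ (lift n)⁺`
  have hmem : ∀ x : ↥(plus n), oldV (x : V s) ∈ plus (lift n) := fun x => by
    rw [plus_lift, Finset.mem_map]
    exact ⟨x, x.2, rfl⟩
  have hsurj : ∀ y : ↥(plus (lift n)), ∃ x : ↥(plus n), oldV (x : V s) = y := fun y => by
    have hy : (y : V (s + 1)) ∈ (plus n).map ⟨oldV, oldV_injective⟩ := by
      rw [← plus_lift]; exact y.2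
    rw [Finset.mem_map] at hy
    obtain ⟨w, hw, hwy⟩ := hy
    exact ⟨⟨w, hw⟩, hwy⟩
  let e : ↥(plus n) ≃ ↥(plus (lift n)) :=
    Equiv.ofBijective (fun x => ⟨oldV (x : V s), hmem x⟩)
      ⟨fun x y hxy => Subtype.ext (oldV_injective (congrArg Subtype.val hxy)),
        fun y => by
          obtain ⟨x, hx⟩ := hsurj y
          exact ⟨x, Subtype.ext hx⟩⟩
  have key : (P'.S.submatrix (fun x : ↥(plus (lift n)) => (x : V (s + 1)))
      (fun x : ↥(plus (lift n)) => (x : V (s + 1)))).submatrix e e =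
      P.S.submatrix (fun x : ↥(plus n) => (x : V s)) (fun x : ↥(plus n) => (x : V s)) := by
    ext x y
    simp only [Matrix.submatrix_apply]
    exact h x y
  unfold Core
  rw [← key, Matrix.det_submatrix_equiv_self]

/-! ## `𝒳⁰(P)` embeds in `𝒳⁰(P')` along `lift` -/

/-- `lift` commutes with symmetric differences. [folklore] -/
theorem lift_symmDiff (n m : Finset (Fin s)) : lift (symmDiff n m) = symmDiff (lift n) (lift m) := by
  unfold lift
  ext j
  simp only [Finset.mem_map, Finset.mem_symmDiff]
  constructor
  · rintro ⟨i, hi, rfl⟩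
    rcases hi with ⟨h1, h2⟩ | ⟨h1, h2⟩
    · exact Or.inl ⟨⟨i, h1, rfl⟩, fun ⟨i', hi', he⟩ => h2 (by
        rwa [Fin.castSuccEmb.injective he] at hi')⟩
    · exact Or.inr ⟨⟨i, h1, rfl⟩, fun ⟨i', hi', he⟩ => h2 (by
        rwa [Fin.castSuccEmb.injective he] at hi')⟩
  · rintro (⟨⟨i, hi, rfl⟩, hnot⟩ | ⟨⟨i, hi, rfl⟩, hnot⟩)
    · exact ⟨i, Or.inl ⟨hi, fun h2 => hnot ⟨i, h2, rfl⟩⟩, rfl⟩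
    · exact ⟨i, Or.inr ⟨hi, fun h2 => hnot ⟨i, h2, rfl⟩⟩, rfl⟩

/-- **Cube adjacency lifts.** [cite: MazurRubin2004, §4.3] -/
theorem cubeAdj_lift {P : Position s} {P' : Position (s + 1)} (h : Extends P P') {n m : Finset (Fin s)}
    (hnm : CubeAdj P n m) : CubeAdj P' (lift n) (lift m) := by
  obtain ⟨hn, hm, hadj⟩ := hnm
  refine ⟨(core_lift_iff h n).mpr hn, (core_lift_iff h m).mpr hm, ?_⟩
  unfold lift
  rcases hadj with ⟨hsub, hc⟩ | ⟨hsub, hc⟩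
  · left
    refine ⟨Finset.map_subset_map.mpr hsub, ?_⟩
    rw [← Finset.map_sdiff, Finset.card_map, hc]
  · right
    refine ⟨Finset.map_subset_map.mpr hsub, ?_⟩
    rw [← Finset.map_sdiff, Finset.card_map, hc]

/-- **Connectivity in `𝒳⁰` lifts along an extension.** [cite: MazurRubin2004, §4.3] -/
theorem connected_lift {P : Position s} {P' : Position (s + 1)} (h : Extends P P') {n m : Finset (Fin s)}
    (hnm : Connected P n m) : Connected P' (lift n) (lift m) :=
  Relation.ReflTransGen.lift (r := CubeAdj P) (p := CubeAdj P') lift (fun _ _ hab => cubeAdj_lift h hab)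
    n m hnm

/-! ## Admissible moves inherit the BAD₁ decoration -/

/-- **An admissible move inherits the decoration as `(lift A, ε₀)`**: the old rows of the consistency
identity are those of `P` (the move is an extension), and the new row's identity IS the admissibility
condition `ψ(c₀) = 1` (lens-2 G5.2 T3 (ii)). [cite: MazurRubin2004, §4.3] -/
theorem bad1Consistent_lift_of_admissibleExtends {P : Position s} {A : Finset (Fin s)} {ε₀ : ZMod 2}
    {P' : Position (s + 1)} (hc : Bad1Consistent P A ε₀) (ha : AdmissibleExtends P A ε₀ P') :
    Bad1Consistent P' (lift A) ε₀ := by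
  classical
  obtain ⟨hext, hadm⟩ := ha
  intro v
  have hsum : ∀ w : V (s + 1), ∑ a ∈ lift A, P'.S w (some a) = ∑ a ∈ A, P'.S w (some a.castSucc) := by
    intro w
    unfold lift
    rw [Finset.sum_map]
    rfl
  rw [hsum]
  by_cases hv : v = Fin.last s
  · -- the new row: admissibility
    subst hv
    have hnot : Fin.last s ∉ lift A := by
      rw [mem_lift_iff]
      rintro ⟨i, -, hi⟩
      exact Fin.castSucc_ne_last i hi
    rw [if_neg hnot, ← hadm, add_comm, mul_comm]
  · -- an old row `v = i.castSucc`
    set i : Fin s := v.castPred hv with hi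
    have hvi : v = i.castSucc := by rw [hi, Fin.castSucc_castPred]
    have hrow := hc i
    have h1 : ∀ a : Fin s, P'.S v (some a.castSucc) = P.S (some i) (some a) := fun a => by
      rw [hvi]; exact hext (some i) (some a)
    have h2 : P'.S v none = P.S (some i) none := by
      rw [hvi]; exact hext (some i) none
    simp_rw [h1, h2]
    have hmem : (v ∈ lift A) ↔ i ∈ A := by
      rw [mem_lift_iff]
      constructor
      · rintro ⟨i', hi', he⟩
        rwa [Fin.castSucc_injective s (he.trans hvi)] at hi'
      · intro hi'
        exact ⟨i, hi', hvi.symm⟩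
    rw [hrow]
    by_cases hiA : i ∈ A
    · rw [if_pos hiA, if_pos (hmem.mpr hiA)]
    · rw [if_neg hiA, if_neg (fun h => hiA (hmem.mp h))]

end Summit.BirchSwinnertonDyer.Rank1Residual.X5.SelmerSolitaire
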